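import Summits.NavierStokesRegularity.JiaSverakCAP.GS17SpectrumAtZeroDivFree
import Summits.NavierStokesRegularity.JiaSverakCAP.GS17SpectrumAtZeroDecay
import Mathlib.Analysis.SpecialFunctions.JapaneseBracket
import HarnessLib

/-!
# Guillod–Šverák Thm 2.1 (1), erratum E2 — part 5: `L²` and `L⁴` integrability of the components of `v` outside
# the unit ball (`JiaSverakCAP.GS17SpectrumAtZero`, continued)

HONEST FRAMING (papers lane (c), PF-P2 writer seat papers-pfp2-w1 g3; companion of p477988 / p479601 / p487640 / p488746).
Measure theory on `EuclideanSpace ℝ (Fin 3)` only; asserts NOTHING about Navier–Stokes. From the pointwise bound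
`|c_a(x)| ≤ (4/√π + 1)‖a‖/‖x‖²` for `‖x‖ ≥ 1` (part 4) and differentiability away from `0` (part 3) it kernel-checks that each
Cartesian component `c_a = swirlComp a` of `v = ∇Φ × e₃` satisfies `∫_{‖x‖ ≥ 1} c_a² < ∞` and `∫_{‖x‖ ≥ 1} c_a⁴ < ∞`
(`integrableOn_swirlComp_sq`, `integrableOn_swirlComp_pow_four`), by comparison with `(1 + ‖x‖)^{−4}` resp. `(1 + ‖x‖)^{−8}`,
integrable on `ℝ³` (`integrable_one_add_norm`; `4, 8 > 3 = dim`). This is the AT-INFINITY half of `v ∈ L² ∩ L⁴`; the unit ball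
(where the Lean functions carry junk values at `0`, the true `v` being smooth), the derivatives `∂^α v`, `x·∇v`, and the reading
of the printed operator remain by hand (arXiv:1704.00560v1 only). [folklore]
-/

open scoped BigOperators RealInnerProductSpace
open Set MeasureTheory

noncomputable section

namespace Summit.NavierStokesRegularity.JiaSverakCAP.GS17SpectrumAtZero

/-- The exterior of the unit ball is a measurable set. [folklore] -/
theorem measurableSet_norm_ge_one : MeasurableSet {x : EuclideanSpace ℝ (Fin 3) | 1 ≤ ‖x‖} :=
  (isClosed_le continuous_const continuous_norm).measurableSet

/-- `swirlComp a` is continuous on the exterior of the unit ball (it is differentiable away from `0`). [folklore] -/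
theorem continuousOn_swirlComp (a : EuclideanSpace ℝ (Fin 3)) :
    ContinuousOn (swirlComp a) {x : EuclideanSpace ℝ (Fin 3) | 1 ≤ ‖x‖} := by
  intro x hx
  have hx1 : 1 ≤ ‖x‖ := hx
  have hx0 : x ≠ 0 := by
    intro h
    rw [h, norm_zero] at hx1
    exact absurd hx1 (by norm_num)
  exact (differentiableAt_swirlComp hx0 a).continuousAt.continuousWithinAt

/-- Comparison: for `‖x‖ ≥ 1`, `1/‖x‖ⁿ ≤ 2ⁿ (1 + ‖x‖)^{−n}`. [folklore] -/
theorem inv_norm_pow_le {x : EuclideanSpace ℝ (Fin 3)} (hx : 1 ≤ ‖x‖) (n : ℕ) :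
    1 / ‖x‖ ^ n ≤ 2 ^ n * (1 + ‖x‖) ^ (-(n : ℝ)) := by
  have hx0 : 0 < ‖x‖ := by linarith
  have h1 : 0 < 1 + ‖x‖ := by linarith
  have hpow : (1 + ‖x‖) ^ n ≤ (2 * ‖x‖) ^ n := pow_le_pow_left₀ h1.le (by linarith) n
  rw [mul_pow] at hpow
  rw [Real.rpow_neg h1.le, Real.rpow_natCast]
  have hrw : (2 : ℝ) ^ n * ((1 + ‖x‖) ^ n)⁻¹ = (2 ^ n * ‖x‖ ^ n) / (1 + ‖x‖) ^ n * (1 / ‖x‖ ^ n) := by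
    field_simp
  rw [hrw]
  have hq : 1 ≤ (2 ^ n * ‖x‖ ^ n) / (1 + ‖x‖) ^ n := by
    rw [le_div_iff₀ (pow_pos h1 n), one_mul]
    exact hpow
  have hpos : 0 ≤ 1 / ‖x‖ ^ n := by positivity
  nlinarith

/-- Integrability of `(1 + ‖x‖)^{−r}` on `ℝ³` for `r > 3`, on any measurable set. [folklore] -/
theorem integrableOn_one_add_norm_rpow {r : ℝ} (hr : 3 < r) (s : Set (EuclideanSpace ℝ (Fin 3))) :
    IntegrableOn (fun x : EuclideanSpace ℝ (Fin 3) => (1 + ‖x‖) ^ (-r)) s := by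
  have h := integrable_one_add_norm (E := EuclideanSpace ℝ (Fin 3)) (μ := volume) (r := r)
    (by rw [finrank_euclideanSpace, Fintype.card_fin]; exact_mod_cast hr)
  exact h.integrableOn

/-- **`c_a ∈ L²` outside the unit ball.** [folklore] -/
theorem integrableOn_swirlComp_sq (a : EuclideanSpace ℝ (Fin 3)) :
    IntegrableOn (fun x => swirlComp a x ^ 2) {x : EuclideanSpace ℝ (Fin 3) | 1 ≤ ‖x‖} := by
  set C : ℝ := (4 / Real.sqrt Real.pi + 1) * ‖a‖ with hC
  have hC0 : 0 ≤ C := by positivity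
  have hg : IntegrableOn (fun x : EuclideanSpace ℝ (Fin 3) => C ^ 2 * (2 ^ 4 * (1 + ‖x‖) ^ (-(4 : ℝ))))
      {x : EuclideanSpace ℝ (Fin 3) | 1 ≤ ‖x‖} :=
    ((integrableOn_one_add_norm_rpow (by norm_num) _).const_mul (2 ^ 4)).const_mul (C ^ 2)
  refine Integrable.mono' hg ?_ ?_
  · exact ((continuousOn_swirlComp a).pow 2).aestronglyMeasurable measurableSet_norm_ge_one
  · refine (ae_restrict_iff' measurableSet_norm_ge_one).2 (ae_of_all _ fun x hx => ?_)
    have hx1 : 1 ≤ ‖x‖ := hx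
    have hx0 : 0 < ‖x‖ := by linarith
    have hb : |swirlComp a x| ≤ C / ‖x‖ ^ 2 := abs_swirlComp_le hx1 a
    have h4 : 1 / ‖x‖ ^ 4 ≤ 2 ^ 4 * (1 + ‖x‖) ^ (-((4 : ℕ) : ℝ)) := inv_norm_pow_le hx1 4
    have h4' : 1 / ‖x‖ ^ 4 ≤ 2 ^ 4 * (1 + ‖x‖) ^ (-(4 : ℝ)) := by exact_mod_cast h4
    rw [Real.norm_eq_abs, abs_pow]
    calc |swirlComp a x| ^ 2 ≤ (C / ‖x‖ ^ 2) ^ 2 := pow_le_pow_left₀ (abs_nonneg _) hb 2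
      _ = C ^ 2 * (1 / ‖x‖ ^ 4) := by field_simp
      _ ≤ C ^ 2 * (2 ^ 4 * (1 + ‖x‖) ^ (-(4 : ℝ))) := mul_le_mul_of_nonneg_left h4' (sq_nonneg _)

/-- **`c_a ∈ L⁴` outside the unit ball.** [folklore] -/
theorem integrableOn_swirlComp_pow_four (a : EuclideanSpace ℝ (Fin 3)) :
    IntegrableOn (fun x => swirlComp a x ^ 4) {x : EuclideanSpace ℝ (Fin 3) | 1 ≤ ‖x‖} := by
  set C : ℝ := (4 / Real.sqrt Real.pi + 1) * ‖a‖ with hC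
  have hC0 : 0 ≤ C := by positivity
  have hg : IntegrableOn (fun x : EuclideanSpace ℝ (Fin 3) => C ^ 4 * (2 ^ 8 * (1 + ‖x‖) ^ (-(8 : ℝ))))
      {x : EuclideanSpace ℝ (Fin 3) | 1 ≤ ‖x‖} :=
    ((integrableOn_one_add_norm_rpow (by norm_num) _).const_mul (2 ^ 8)).const_mul (C ^ 4)
  refine Integrable.mono' hg ?_ ?_
  · exact ((continuousOn_swirlComp a).pow 4).aestronglyMeasurable measurableSet_norm_ge_one
  · refine (ae_restrict_iff' measurableSet_norm_ge_one).2 (ae_of_all _ fun x hx => ?_)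
    have hx1 : 1 ≤ ‖x‖ := hx
    have hx0 : 0 < ‖x‖ := by linarith
    have hb : |swirlComp a x| ≤ C / ‖x‖ ^ 2 := abs_swirlComp_le hx1 a
    have h8 : 1 / ‖x‖ ^ 8 ≤ 2 ^ 8 * (1 + ‖x‖) ^ (-((8 : ℕ) : ℝ)) := inv_norm_pow_le hx1 8
    have h8' : 1 / ‖x‖ ^ 8 ≤ 2 ^ 8 * (1 + ‖x‖) ^ (-(8 : ℝ)) := by exact_mod_cast h8
    rw [Real.norm_eq_abs, abs_pow]
    calc |swirlComp a x| ^ 4 ≤ (C / ‖x‖ ^ 2) ^ 4 := pow_le_pow_left₀ (abs_nonneg _) hb 4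
      _ = C ^ 4 * (1 / ‖x‖ ^ 8) := by field_simp
      _ ≤ C ^ 4 * (2 ^ 8 * (1 + ‖x‖) ^ (-(8 : ℝ))) := mul_le_mul_of_nonneg_left h8' (by positivity)

end Summit.NavierStokesRegularity.JiaSverakCAP.GS17SpectrumAtZero

end
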